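import Summits.BirchSwinnertonDyer.BirchSwinnertonDyer.Theses.NormCapitulation
import Summits.BirchSwinnertonDyer.BirchSwinnertonDyer.Theorems.ShadowIsolationSelmerRankUBGreenbergSplit
import Summits.BirchSwinnertonDyer.BirchSwinnertonDyer.Theorems.NormCapitulationClosesWithoutR
import HarnessLib

/-!
# BirchSwinnertonDyer / NormCapitulation — crux `SelmerRankUB` (stmt-BirchSwinnertonDyer-0130),
# line `greenberg-split`: the crux's net debt on the third wanting route

The crux `SelmerRankUB` (upper half of `p^∞`-Selmer BSD at a big-image good ordinary prime `p ≥ 5`: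
`corank_{ℤ_p} Sel_{p^∞}(E/ℚ) ≤ ord_{s=1} L(E,s)`) is wanted verbatim by three routes: SelmerRank
(#3), ShadowIsolation (#4) and — since 2026-08-17 — NormCapitulation (#4). Line `greenberg-split`
(skeleton `Cruxes/SelmerRankUB/Lines/greenberg_split.lean`, stubs registered on the item) splits the
crux by Greenberg's PROVED identity `corank Sel_{p^∞} = rank + corank Ш[p^∞]`
(`WeierstrassCurve.selmerCorank_eq_mordellWeilRank_add_holds`) into the GZK cell (`r_an ≤ 1`), the
rank half (`rank ≤ r_an` in `r_an ≥ 2`) and the Ш-half (`corank Ш[p^∞] = 0`); the composition and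
the net-debt certificates for SelmerRank and ShadowIsolation are landed in
`Theorems.ShadowIsolationSelmerRankUBGreenbergSplit`.

This file does the same bookkeeping for route NormCapitulation:

* `normCapitulation_selmerRankUB_iff` — its decl is `rfl`-equal to ShadowIsolation's;
* the Ш-half at every IRREDUCIBLE good ordinary `p ≥ 5` is carried by that route's own items
  `UniversalNorm`, `PhantomCapitulation`, `NormHerbrandBound`, `CapitulationSqueeze` — the junction
  (J) of its certified `closes`, ALREADY LANDED as `normCapitulation_shaCotorsion_of_junction`
  (`Theorems.NormCapitulationClosesWithoutR`, imported, not restated);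
* `shaCotorsionBigImage_of_normCapitulation_items` — hence the line's Ш-stub there (surjective ⇒
  irreducible);
* `selmerRankUBNormCapitulation_of_items_of_squeezeUB` — NET DEBT: those four items + the sibling
  crux `SqueezeUB` (stmt-0496, the rank half) + `RankLeOne` (the Gross–Zagier–Kolyvagin cell, a
  registered item with the statement of the named fact
  `rank_eq_analyticRank_of_analyticRank_le_one`) give `NormCapitulation.SelmerRankUB`; and the
  TangentCone form `selmerRankUBNormCapitulation_of_items_of_edge` with `EdgeDecay ∧ EdgeCap` in
  place of `SqueezeUB`.

So on NormCapitulation, exactly as on the two older routes, the crux has no content of its own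
beyond the non-CM, `r_an ≥ 2` case of `SqueezeUB` plus the GZK fact. Every hypothesis below is a
registered item; no definition is introduced. Sources: Greenberg, LNM 1716 (1999), §1; Darmon,
CBMS 101 (2004), Thm. 3.22; Bertolini, Compositio 99 (1995) (the universal-norm setting).
-/

-- D-0017: single-problem summit, so `Summit.BirchSwinnertonDyer.BirchSwinnertonDyer.…` repeats a
-- namespace BY DESIGN.
set_option linter.dupNamespace false

namespace Summit.BirchSwinnertonDyer.BirchSwinnertonDyer.Theorems

open Summit.BirchSwinnertonDyer.BirchSwinnertonDyer.Theses

/-- Route NormCapitulation's decl `SelmerRankUB` is `rfl`-equal to route ShadowIsolation's (and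
hence to route SelmerRank's): one proof closes the crux on all three routes. [folklore] -/
theorem normCapitulation_selmerRankUB_iff :
    Summit.BirchSwinnertonDyer.BirchSwinnertonDyer.Theses.NormCapitulation.SelmerRankUB ↔
      Summit.BirchSwinnertonDyer.BirchSwinnertonDyer.Theses.ShadowIsolation.SelmerRankUB :=
  Iff.rfl

/-- **Stub `stub_shaCotorsionBigImage` of line `greenberg-split` discharged on route
NormCapitulation** by its four Ш-items, through the landed junction
`normCapitulation_shaCotorsion_of_junction` (a surjective `ρ̄_{E,p}` is irreducible,
`shaCotorsionBigImage_irreducible_of_surjective`; the binder `2 ≤ r_an` is not used). [folklore] -/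
theorem shaCotorsionBigImage_of_normCapitulation_items :
    Summit.BirchSwinnertonDyer.BirchSwinnertonDyer.Theses.NormCapitulation.UniversalNorm →
    Summit.BirchSwinnertonDyer.BirchSwinnertonDyer.Theses.NormCapitulation.PhantomCapitulation →
    Summit.BirchSwinnertonDyer.BirchSwinnertonDyer.Theses.NormCapitulation.NormHerbrandBound →
    Summit.BirchSwinnertonDyer.BirchSwinnertonDyer.Theses.NormCapitulation.CapitulationSqueeze →
    ∀ (W : WeierstrassCurve ℚ) [W.IsElliptic] [W.IsGloballyMinimal] (p : ℕ) [Fact p.Prime],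
      5 ≤ p → W.HasGoodReductionAtPrime p → ¬ (p : ℤ) ∣ W.frobeniusTrace p →
        W.HasSurjectiveModNGaloisRep p → 2 ≤ W.analyticRank → W.shaCorank p = 0 :=
  fun hUN hCap hHerb hSq W _ _ p _ h5 hgood hord hsurj _ =>
    normCapitulation_shaCotorsion_of_junction hUN hCap hHerb hSq W p h5 hgood hord
      (shaCotorsionBigImage_irreducible_of_surjective W p hsurj)

/-- **Net debt of the crux inside route NormCapitulation, `SqueezeUB` form** (every hypothesis is a
registered item): the route's own Ш-items `UniversalNorm`, `PhantomCapitulation`,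
`NormHerbrandBound`, `CapitulationSqueeze` + the sibling crux `SqueezeUB` (stmt-0496, the rank half)
+ TangentCone's `RankLeOne` (the Gross–Zagier–Kolyvagin cell) give `NormCapitulation.SelmerRankUB`,
through the landed composition `selmerRankUB_of_greenbergSplit`. [folklore] -/
theorem selmerRankUBNormCapitulation_of_items_of_squeezeUB :
    Summit.BirchSwinnertonDyer.BirchSwinnertonDyer.Theses.NormCapitulation.UniversalNorm →
    Summit.BirchSwinnertonDyer.BirchSwinnertonDyer.Theses.NormCapitulation.PhantomCapitulation →
    Summit.BirchSwinnertonDyer.BirchSwinnertonDyer.Theses.NormCapitulation.NormHerbrandBound →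
    Summit.BirchSwinnertonDyer.BirchSwinnertonDyer.Theses.NormCapitulation.CapitulationSqueeze →
    Summit.BirchSwinnertonDyer.BirchSwinnertonDyer.Theses.Squeeze.SqueezeUB →
    Summit.BirchSwinnertonDyer.BirchSwinnertonDyer.Theses.TangentCone.RankLeOne →
    Summit.BirchSwinnertonDyer.BirchSwinnertonDyer.Theses.NormCapitulation.SelmerRankUB :=
  fun hUN hCap hHerb hSq hSqz hR1 =>
    normCapitulation_selmerRankUB_iff.mpr
      (selmerRankUB_of_greenbergSplit (gzkSelmerCell_of_rankLeOne hR1)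
        (noExcessRankBigImage_of_squeezeUB hSqz)
        (shaCotorsionBigImage_of_normCapitulation_items hUN hCap hHerb hSq))

/-- **Net debt of the crux inside route NormCapitulation, TangentCone form** (every hypothesis is a
registered item): the four Ш-items + TangentCone's `EdgeDecay`, `EdgeCap` (the rank half at one
admissible prime, `noExcessRankBigImage_of_edgeDecay_of_edgeCap`) + `RankLeOne` give
`NormCapitulation.SelmerRankUB`. No `SqueezeUB`, no `SelmerRankShaPFinite`. [folklore] -/
theorem selmerRankUBNormCapitulation_of_items_of_edge :
    Summit.BirchSwinnertonDyer.BirchSwinnertonDyer.Theses.NormCapitulation.UniversalNorm →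
    Summit.BirchSwinnertonDyer.BirchSwinnertonDyer.Theses.NormCapitulation.PhantomCapitulation →
    Summit.BirchSwinnertonDyer.BirchSwinnertonDyer.Theses.NormCapitulation.NormHerbrandBound →
    Summit.BirchSwinnertonDyer.BirchSwinnertonDyer.Theses.NormCapitulation.CapitulationSqueeze →
    Summit.BirchSwinnertonDyer.BirchSwinnertonDyer.Theses.TangentCone.EdgeDecay →
    Summit.BirchSwinnertonDyer.BirchSwinnertonDyer.Theses.TangentCone.EdgeCap →
    Summit.BirchSwinnertonDyer.BirchSwinnertonDyer.Theses.TangentCone.RankLeOne →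
    Summit.BirchSwinnertonDyer.BirchSwinnertonDyer.Theses.NormCapitulation.SelmerRankUB :=
  fun hUN hCap hHerb hSq hE hC hR1 =>
    normCapitulation_selmerRankUB_iff.mpr
      (selmerRankUB_of_greenbergSplit (gzkSelmerCell_of_rankLeOne hR1)
        (noExcessRankBigImage_of_edgeDecay_of_edgeCap hE hC)
        (shaCotorsionBigImage_of_normCapitulation_items hUN hCap hHerb hSq))

/-- **Conversely, on route NormCapitulation too the crux returns the rank half**: granted the
route's four Ш-items, `NormCapitulation.SelmerRankUB` is EQUIVALENT, modulo the GZK cell, to the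
rank stub `stub_noExcessRankBigImage` (landed exactness `selmerRankUB_iff_noExcessRankBigImage`).
[cite: GreenbergLNM1716, §1] -/
theorem selmerRankUBNormCapitulation_iff_noExcessRankBigImage
    (hUN : NormCapitulation.UniversalNorm) (hCap : NormCapitulation.PhantomCapitulation)
    (hHerb : NormCapitulation.NormHerbrandBound) (hSq : NormCapitulation.CapitulationSqueeze)
    (hR1 : TangentCone.RankLeOne) :
    Summit.BirchSwinnertonDyer.BirchSwinnertonDyer.Theses.NormCapitulation.SelmerRankUB ↔
      ∀ (W : WeierstrassCurve ℚ) [W.IsElliptic] [W.IsGloballyMinimal] (p : ℕ) [Fact p.Prime],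
        5 ≤ p → W.HasGoodReductionAtPrime p → ¬ (p : ℤ) ∣ W.frobeniusTrace p →
          W.HasSurjectiveModNGaloisRep p → 2 ≤ W.analyticRank →
            W.mordellWeilRank ≤ W.analyticRank :=
  normCapitulation_selmerRankUB_iff.trans
    (selmerRankUB_iff_noExcessRankBigImage (gzkSelmerCell_of_rankLeOne hR1)
      (shaCotorsionBigImage_of_normCapitulation_items hUN hCap hHerb hSq))

end Summit.BirchSwinnertonDyer.BirchSwinnertonDyer.Theorems
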